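import Literature.NumberTheory.EllipticCurves.HasseWeilAbelianEulerFactorTorsion
import Literature.NumberTheory.GaloisRepresentations.CyclotomicCharacterReductionProofs
import HarnessLib

/-!
# Euler factors of an elliptic curve at the split multiplicative places: the Frobenius-only route

Topic `NumberTheory/EllipticCurves`, sequel of `HasseWeilAbelianEulerFactorTorsion` (the
torsion-point forms of Serre–Tate's Lemma 2 at the multiplicative places and the corrected
Euler-factor fact `WeierstrassCurve.hasseWeilEulerFactor_geomPoints_of_isElliptic` from them).

The split-multiplicative leaf there, `serreTate_smul_torsion_of_hasSplitMultiplicativeReductionAt`,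
describes the action of the **whole decomposition group** `D_𝔓` on `c • E(K̄)^{I_𝔓}[ℓⁿ]`
(through `χ_ℓ mod ℓⁿ`), because the bad-place fact it serves,
`inertiaCoinvariants_rationalTate_of_hasSplitMultiplicativeReductionAt` (`HasseWeilAbelianBadReduction`),
asks every `σ ∈ D_𝔓` to act trivially on the coinvariant line.  But the Euler factor
`Literature.NumberTheory.EllipticCurves.hasseWeilEulerFactor` only ever evaluates **arithmetic
Frobenius elements** (`hasseWeilEulerFactor_eq_of_finrank_eq_one` quantifies over
`σ ∈ D_𝔓` with `IsArithFrobAt (𝓞 K) σ 𝔓`), and for those the Galois side is elementary and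
global: `σ x ≡ x^{N v} (mod 𝔓)` on `\bar ℤ_K`, so `σ ζ = ζ^{N v}` on the `ℓ`-power roots of unity
(`𝔓 ∤ ℓ`).  A discharge along Frobenius elements needs no identification of `D_𝔓` with a local
Galois group.  This file provides that route:

* `Literature.NumberTheory.GaloisRepresentations.GaloisRep.toZModPow_cyclotomicCharacter_of_isArithFrobAt`:
  **`χ_ℓ(σ) ≡ N v (mod ℓⁿ)`** for an arithmetic Frobenius `σ` at `𝔓 ∣ v ∤ ℓ`, for `K` in any
  universe (the tree's `cyclotomicCharacter_apply_of_isArithFrobAt` is stated for `K : Type`);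
  `nsmul_eq_nsmul_of_toZModPow_eq` (bookkeeping on `ℓⁿ`-torsion);
* `WeierstrassCurve.serreTate_frobenius_smul_torsion_of_hasSplitMultiplicativeReductionAt W ℓ`
  (**named fact**, Serre–Tate §1 Lemmas 1–2 + split torus, Frobenius only): at a split
  multiplicative place `v ∤ ℓ`, `𝔓 ∣ v`, there is `c ≠ 0` with `σ(c • P) = N v • (c • P)` for
  every arithmetic Frobenius `σ` at `𝔓` and every `I_𝔓`-fixed `P ∈ E(K̄)[ℓⁿ]`; it follows from
  the `D_𝔓`-fact (`…_of_torsion`), and its geometric input shape is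
  `Literature.NumberTheory.EllipticCurves.smul_nsmul_eq_residueCard_smul_of_reduction`
  (`HasseWeilAbelianEulerFactorTorsionProofs`);
* (proved) `frobenius_smul_fixedSubmodule_inertia_rationalTate_of_hasSplitMultiplicativeReductionAt_of_frobenius_torsion`
  (Frobenius acts on `(V_ℓ E)^{I_𝔓}` as `N v`),
  `toInertiaCoinvariants_eq_id_of_hasSplitMultiplicativeReductionAt_of_frobenius_torsion` (with
  `codim (V_ℓ E)^{I_𝔓} = 1`: the coinvariants are a line with trivial Frobenius, since
  `det ρ_{E,ℓ}(Frob) = N v`),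
  `hasseWeilEulerFactor_of_hasSplitMultiplicativeReductionAt_of_codim_of_frobenius_torsion`
  (`det(1 - σ T ∣ (V_ℓ E)_{I_v}) = 1 - T`);
* (proved) **assembly**: `hasseWeilEulerFactor_geomPoints_of_isElliptic_of_codim_of_frobenius_torsion`
  — the corrected Euler-factor fact from the two bad-place cases of Silverman *ATAEC*
  Thm. IV.10.2(a) and the two Frobenius torsion facts (split: this file; non-split:
  `serreTate_frobenius_smul_torsion_of_hasNonsplitMultiplicativeReductionAt`) — and
  `hasseWeilEulerFactor_geomPoints_of_isElliptic_of_serreTate_of_frobenius_torsion`: **from the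
  dimension form of Serre–Tate's Lemma 2 and the two Frobenius torsion facts (three leaves, all
  Frobenius-only on the Galois side)**; pointwise schema instance for elliptic `W`.

## References

* J.-P. Serre, J. Tate, *Good reduction of abelian varieties*, Ann. of Math. (2) 88 (1968),
  §1 Lemma 1, Lemma 2 (p. 495), §2 Thm. 3. [SerreTate1968]
* J.-P. Serre, *Abelian `ℓ`-adic representations and elliptic curves* (1968), Ch. I §1.2
  (`χ_ℓ(F_v) = N v`). [SerreAbelianLadic1968]
* J. H. Silverman, *The Arithmetic of Elliptic Curves*, 2nd ed. (2009): Prop. III.2.5,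
  Exercise 3.5, Thm. VII.6.1, C.§16 (PDF pp. 59, 97, 177, 390). [SilvermanAEC2009]
* J. H. Silverman, *Advanced Topics in the Arithmetic of Elliptic Curves* (1994): Thm. IV.10.2(a)
  (PDF p. 358), Exercise 5.13 (PDF p. 416). [SilvermanATAEC1994]

## Design

`noncomputable section`, one universe `u`; the named fact has the quantifier layout of
`serreTate_frobenius_smul_torsion_of_hasNonsplitMultiplicativeReductionAt` (`∀ [W.IsElliptic] (v)
(hℓ) (hv) {𝔓} (h𝔓), ∃ c ≠ 0, ∀ ⦃σ⦄, IsArithFrobAt (𝓞 K) σ 𝔓 → …`).  Deliberate dot-notation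
extensions of Mathlib's `WeierstrassCurve` namespace; the cyclotomic lemma in
`Literature.NumberTheory.GaloisRepresentations`.  No instances, no `sorry`; the only `def` is the
named fact.
-/

noncomputable section

open Module Polynomial

universe u

/-! ### `χ_ℓ(Frob_v) ≡ N v (mod ℓⁿ)` (universe-polymorphic) and torsion bookkeeping -/

namespace Literature.NumberTheory.GaloisRepresentations

open scoped NumberField
open Field IsDedekindDomain

variable {K : Type u} [Field K] [NumberField K] (ℓ : ℕ) [Fact ℓ.Prime]

/-- **`χ_ℓ(σ) ≡ N v (mod ℓⁿ)` for an arithmetic Frobenius `σ` at `𝔓 ∣ v ∤ ℓ`** (Serre, *Abelian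
`ℓ`-adic representations*, I.1.2: `χ_ℓ(F_v) = N v`), for a number field `K` in any universe (the
tree's `GaloisRep.cyclotomicCharacter_apply_of_isArithFrobAt` is the `ℤ_ℓ`-valued statement for
`K : Type`): both `χ_ℓ(σ) mod ℓⁿ` and `N v` are the exponent by which `σ` acts on a primitive
`ℓⁿ`-th root of unity of `\bar ℤ_K` (`absIntegers.smul_eq_pow_cyclotomicCharacter_of_pow_eq_one`;
Mathlib `AlgHom.IsArithFrobAt.apply_of_pow_eq_one`, roots of unity of order prime to `p` being
distinct modulo `𝔓`). [cite: SerreAbelianLadic1968, Ch. I §1.2] -/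
theorem GaloisRep.toZModPow_cyclotomicCharacter_of_isArithFrobAt {v : HeightOneSpectrum (𝓞 K)}
    (hv : (ℓ : 𝓞 K) ∉ v.asIdeal) {𝔓 : Ideal (absIntegers (𝓞 K) K)} (h𝔓 : 𝔓 ∈ v.primesAbove)
    {σ : absoluteGaloisGroup K} (hσ : IsArithFrobAt (𝓞 K) σ 𝔓) (n : ℕ) :
    ((GaloisRep.cyclotomicCharacter K ℓ σ : ℤ_[ℓ]ˣ) : ℤ_[ℓ]).toZModPow n =
      (v.residueCard : ZMod (ℓ ^ n)) := by
  haveI : 𝔓.IsPrime := h𝔓.1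
  haveI : NeZero (ℓ ^ n) := ⟨pow_ne_zero n (Fact.out : ℓ.Prime).ne_zero⟩
  haveI : NeZero (ℓ : K) := ⟨Nat.cast_ne_zero.mpr (Fact.out : ℓ.Prime).ne_zero⟩
  obtain ⟨ζ, hζ⟩ := exists_isPrimitiveRoot_absIntegers K (ℓ ^ n)
  have hζ' : IsPrimitiveRoot (ζ : AlgebraicClosure K) (ℓ ^ n) :=
    hζ.map_of_injective (f := (absIntegers (𝓞 K) K).val) Subtype.val_injective
  have hℓn : ((ℓ ^ n : ℕ) : absIntegers (𝓞 K) K) ∉ 𝔓 := by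
    rw [Nat.cast_pow]
    exact fun hmem ↦ absIntegers.natCast_notMem_of_mem_primesAbove hv h𝔓
      (Ideal.IsPrime.mem_of_pow_mem inferInstance n hmem)
  -- in `K̄`: `σ ζ = ζ ^ (χ mod ℓⁿ)` and `σ ζ = ζ ^ N v`
  have h1 : σ • (ζ : AlgebraicClosure K) = (ζ : AlgebraicClosure K) ^
      (((GaloisRep.cyclotomicCharacter K ℓ σ : ℤ_[ℓ]ˣ) : ℤ_[ℓ]).toZModPow n).val :=
    GaloisRep.cyclotomicCharacter_spec K ℓ σ _ hζ'.pow_eq_one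
  have h2 : σ • (ζ : AlgebraicClosure K) = (ζ : AlgebraicClosure K) ^ v.residueCard := by
    have h := hσ.apply_of_pow_eq_one hζ.pow_eq_one hℓn
    rw [MulSemiringAction.toAlgHom_apply,
      HeightOneSpectrum.card_quotient_under_eq_residueCard h𝔓] at h
    have h' := congrArg (fun z : absIntegers (𝓞 K) K ↦ (z : AlgebraicClosure K)) h
    simpa [integralClosure.coe_smul] using h'
  have h3 := h1.symm.trans h2
  have hfin : IsOfFinOrder (ζ : AlgebraicClosure K) :=
    isOfFinOrder_iff_pow_eq_one.mpr ⟨ℓ ^ n, pow_pos (Fact.out : ℓ.Prime).pos n, hζ'.pow_eq_one⟩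
  rw [hfin.pow_eq_pow_iff_modEq, ← hζ'.eq_orderOf] at h3
  have h4 := (ZMod.natCast_eq_natCast_iff _ _ _).mpr h3
  rwa [ZMod.natCast_zmod_val] at h4

omit [NumberField K] in
/-- On an `ℓⁿ`-torsion element, `(χ_ℓ(σ) mod ℓⁿ) • b` only depends on `χ_ℓ(σ) mod ℓⁿ`: if
`χ_ℓ(σ) ≡ q (mod ℓⁿ)` then `(χ_ℓ(σ) mod ℓⁿ) • b = q • b`. [folklore] -/
theorem nsmul_eq_nsmul_of_toZModPow_eq {M : Type*} [AddCommMonoid M] {n : ℕ} {b : M}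
    (hb : ℓ ^ n • b = 0) {u : ℤ_[ℓ]} {q : ℕ} (hu : u.toZModPow n = (q : ZMod (ℓ ^ n))) :
    (u.toZModPow n).val • b = q • b := by
  rw [hu, ZMod.val_natCast]
  conv_rhs => rw [← Nat.mod_add_div q (ℓ ^ n), add_smul, mul_comm, mul_smul, hb, smul_zero,
    add_zero]

end Literature.NumberTheory.GaloisRepresentations

namespace WeierstrassCurve

open Literature.NumberTheory.EllipticCurves Literature.NumberTheory.GaloisRepresentations
open scoped NumberField
open Field IsDedekindDomain

variable {K : Type u} [Field K] [NumberField K] (W : WeierstrassCurve K) (ℓ : ℕ) [Fact ℓ.Prime]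

/-! ### Serre–Tate's Lemma 2 at a split multiplicative place, Frobenius only (named fact) -/

section Fact

/-- **Serre–Tate's Lemma 2 at a split multiplicative place, on torsion points, for Frobenius
elements: an arithmetic Frobenius acts on `c • E(K̄)^{I_𝔓}[ℓⁿ]` as `N v`.**  For an elliptic
curve `E/K` over a number field with split multiplicative reduction at the finite place `v ∤ ℓ`
and a prime `𝔓 ∣ v` of `\bar ℤ_K`, there is an integer `c ≠ 0` such that for every arithmetic
Frobenius `σ ∈ Γ_K` at `𝔓` (Mathlib `IsArithFrobAt`: `σ x ≡ x^{N v} mod 𝔓`), every `n` and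
every point `P ∈ E(K̄)` fixed by the inertia group `I_𝔓` with `ℓⁿ P = O`:
`σ(cP) = [N v](cP)`.  Printed sources: Serre–Tate, §1 Lemma 2, *"The reduction map defines an
isomorphism of `A_m^I` onto `Ã_m`.  This isomorphism commutes with the action of `D(v̄)`"*, with
Lemma 1 (`c • Ã_m ⊆ Ã⁰_m`, `c = (Ã : Ã⁰)`); at a split node `Ã⁰ = Ẽ_ns ≅ 𝔾_m` over `k_v`
(Silverman, *AEC*, Prop. III.2.5(a), Exercise 3.5(a)(i), VII.§5), so `Ã⁰_{ℓⁿ} = μ_{ℓⁿ}(k̄_v)`, on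
which the `N v`-power Frobenius acts as `ζ ↦ ζ^{N v}`; `c = v(Δ_min)` by Kodaira–Néron (*AEC*
Thm. VII.6.1).  Equivalently Silverman, *ATAEC*, Exercise 5.13(a),(b) (`T_ℓ(E)^{I} = T_ℓ(μ)`) with
`χ_ℓ(Frob_v) = N v` (Serre, *Abelian `ℓ`-adic representations*, I.1.2).  This is the special
case `σ` = Frobenius of `serreTate_smul_torsion_of_hasSplitMultiplicativeReductionAt`
(`serreTate_frobenius_smul_torsion_of_hasSplitMultiplicativeReductionAt_of_torsion`), and it is
all that the Euler factor needs (`hasseWeilEulerFactor_of_hasSplitMultiplicativeReductionAt_of_codim_of_frobenius_torsion`);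
its geometric input shape is
`Literature.NumberTheory.EllipticCurves.smul_nsmul_eq_residueCard_smul_of_reduction`
(`HasseWeilAbelianEulerFactorTorsionProofs`).
[cite: SerreTate1968, §1 Lemma 1 and Lemma 2 (p. 495)]
[cite: SilvermanAEC2009, Prop. III.2.5(a), Exercise 3.5(a)(i), Thm. VII.6.1 (PDF pp. 59, 97, 177)]
[cite: SilvermanATAEC1994, Exercise 5.13(a),(b) (PDF p. 416)] -/
def serreTate_frobenius_smul_torsion_of_hasSplitMultiplicativeReductionAt : Prop :=
  ∀ [W.IsElliptic] (v : HeightOneSpectrum (𝓞 K)) (_hℓ : (ℓ : 𝓞 K) ∉ v.asIdeal)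
    (_hv : W.HasSplitMultiplicativeReductionAt v)
    {𝔓 : Ideal (absIntegers (𝓞 K) K)} (_h𝔓 : 𝔓 ∈ v.primesAbove),
    ∃ c : ℕ, c ≠ 0 ∧
      ∀ ⦃σ : absoluteGaloisGroup K⦄ (_hσ : IsArithFrobAt (𝓞 K) σ 𝔓) (n : ℕ) (P : geomPoints W),
        (∀ τ ∈ 𝔓.inertia (absoluteGaloisGroup K), τ • P = P) → ℓ ^ n • P = 0 →
        σ • (c • P) = v.residueCard • (c • P)

end Fact

section Derivations

/-- The Frobenius-only fact from the `D_𝔓`-fact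
`serreTate_smul_torsion_of_hasSplitMultiplicativeReductionAt` (`χ_ℓ(σ) ≡ N v mod ℓⁿ` for an
arithmetic Frobenius `σ`, `GaloisRep.toZModPow_cyclotomicCharacter_of_isArithFrobAt`; `σ ∈ D_𝔓`
by `IsArithFrobAt.mem_stabilizer`). [folklore] -/
theorem serreTate_frobenius_smul_torsion_of_hasSplitMultiplicativeReductionAt_of_torsion
    (hB : W.serreTate_smul_torsion_of_hasSplitMultiplicativeReductionAt ℓ) :
    W.serreTate_frobenius_smul_torsion_of_hasSplitMultiplicativeReductionAt ℓ := by
  intro _ v hℓ hv 𝔓 h𝔓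
  haveI : 𝔓.IsPrime := h𝔓.1
  obtain ⟨c, hc, hyp⟩ := hB v hℓ hv h𝔓
  refine ⟨c, hc, fun σ hσ n P hP hPn ↦ ?_⟩
  have h := hyp ⟨σ, hσ.mem_stabilizer⟩ n P hP hPn
  rw [h]
  exact nsmul_eq_nsmul_of_toZModPow_eq ℓ (by rw [smul_comm, hPn, smul_zero])
    (GaloisRep.toZModPow_cyclotomicCharacter_of_isArithFrobAt ℓ hℓ h𝔓 hσ n)

/-- **An arithmetic Frobenius acts on `(V_ℓ E)^{I_𝔓}` as `N v` at a split multiplicative place**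
(Silverman, *ATAEC*, Exercise 5.13(a),(b): `(V_ℓ E)^{I} = V_ℓ(μ)`; Serre I.1.2: `χ_ℓ(F_v) = N v`),
from the Frobenius-only torsion fact, by
`RationalTateModule.rationalTateRepresentation_eq_smul_of_forall_torsion`.
[cite: SilvermanATAEC1994, Exercise 5.13(a),(b) (PDF p. 416)] [cite: SerreTate1968, §1 Lemma 2] -/
theorem frobenius_smul_fixedSubmodule_inertia_rationalTate_of_hasSplitMultiplicativeReductionAt_of_frobenius_torsion
    [W.IsElliptic] (hBF : W.serreTate_frobenius_smul_torsion_of_hasSplitMultiplicativeReductionAt ℓ)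
    (h : Continuous fun x : absoluteGaloisGroup K × RationalTateModule (geomPoints W) ℓ ↦
      rationalTateRepresentation (absoluteGaloisGroup K) (geomPoints W) ℓ x.1 x.2)
    {v : HeightOneSpectrum (𝓞 K)} (hℓ : (ℓ : 𝓞 K) ∉ v.asIdeal)
    (hv : W.HasSplitMultiplicativeReductionAt v)
    {𝔓 : Ideal (absIntegers (𝓞 K) K)} (h𝔓 : 𝔓 ∈ v.primesAbove)
    {σ : absoluteGaloisGroup K} (hσ : IsArithFrobAt (𝓞 K) σ 𝔓)
    {e : RationalTateModule (geomPoints W) ℓ}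
    (he : e ∈ (rationalTateGaloisRepOf (geomPoints W) ℓ h).fixedSubmodule
      (𝔓.inertia (absoluteGaloisGroup K))) :
    rationalTateRepresentation (absoluteGaloisGroup K) (geomPoints W) ℓ σ e =
      (v.residueCard : ℚ_[ℓ]) • e := by
  obtain ⟨c, hc, hyp⟩ := hBF v hℓ hv h𝔓
  rw [ContinuousRep.mem_fixedSubmodule] at he
  have key := RationalTateModule.rationalTateRepresentation_eq_smul_of_forall_torsion
    (𝔓.inertia (absoluteGaloisGroup K)) σ (v.residueCard : ℤ_[ℓ]) hc (fun n a ha hn ↦ ?_) he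
  · rwa [PadicInt.coe_natCast] at key
  · rw [hyp hσ n a ha hn]
    exact (nsmul_eq_nsmul_of_toZModPow_eq ℓ (by rw [smul_comm, hn, smul_zero])
      (map_natCast _ _)).symm

/-- **`(V_ℓ E)_{I_𝔓}` at a split multiplicative place is a line on which every arithmetic
Frobenius acts trivially**, from `codim (V_ℓ E)^{I_𝔓} = 1` (Silverman *ATAEC* Thm. IV.10.2(a),
`codimFixed_inertia_rationalTate_eq_one_of_hasMultiplicativeReductionAt`) and the Frobenius-only
torsion fact: Frobenius acts on the invariant line as `N v` and `det ρ_{E,ℓ}(Frob) = N v`, so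
it acts on the coinvariant line `V_ℓ E/(V_ℓ E)^{I}` as `1`
(`toInertiaCoinvariants_eq_smul_id_of_codimFixed_eq_one`).  This is the Frobenius part of
`inertiaCoinvariants_rationalTate_of_hasSplitMultiplicativeReductionAt`, and all that the Euler
factor uses. [cite: SilvermanATAEC1994, Exercise 5.13(a),(b) (PDF p. 416)] -/
theorem toInertiaCoinvariants_eq_id_of_hasSplitMultiplicativeReductionAt_of_frobenius_torsion
    [W.IsElliptic] (hTm : W.codimFixed_inertia_rationalTate_eq_one_of_hasMultiplicativeReductionAt ℓ)
    (hBF : W.serreTate_frobenius_smul_torsion_of_hasSplitMultiplicativeReductionAt ℓ)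
    (h : Continuous fun x : absoluteGaloisGroup K × RationalTateModule (geomPoints W) ℓ ↦
      rationalTateRepresentation (absoluteGaloisGroup K) (geomPoints W) ℓ x.1 x.2)
    {v : HeightOneSpectrum (𝓞 K)} (hℓ : (ℓ : 𝓞 K) ∉ v.asIdeal)
    (hv : W.HasSplitMultiplicativeReductionAt v)
    {𝔓 : Ideal (absIntegers (𝓞 K) K)} (h𝔓 : 𝔓 ∈ v.primesAbove) :
    Module.finrank ℚ_[ℓ] ((rationalTateGaloisRepOf (geomPoints W) ℓ h).InertiaCoinvariants 𝔓) = 1 ∧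
      ∀ σ : 𝔓.decompositionSubgroup (absoluteGaloisGroup K),
        IsArithFrobAt (𝓞 K) (σ : absoluteGaloisGroup K) 𝔓 →
          (rationalTateGaloisRepOf (geomPoints W) ℓ h).toInertiaCoinvariants 𝔓 σ = LinearMap.id := by
  have hcodim := hTm h v hℓ hv.hasMultiplicativeReductionAt h𝔓
  refine ⟨?_, fun σ hσ ↦ ?_⟩
  · rw [W.finrank_inertiaCoinvariants_eq_two_sub_codimFixed ℓ h hℓ h𝔓, hcodim]
  · have hq : (v.residueCard : ℚ_[ℓ]) ≠ 0 :=
      Nat.cast_ne_zero.mpr (ne_of_gt (lt_trans zero_lt_one v.one_lt_residueCard))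
    have := W.toInertiaCoinvariants_eq_smul_id_of_codimFixed_eq_one ℓ h hℓ h𝔓 hcodim σ (c := 1) hq
      (fun e he ↦
        W.frobenius_smul_fixedSubmodule_inertia_rationalTate_of_hasSplitMultiplicativeReductionAt_of_frobenius_torsion
          ℓ hBF h hℓ hv h𝔓 hσ he)
      (by rw [mul_one, W.det_rationalTateRepresentation_of_isArithFrobAt ℓ hℓ h𝔓 hσ])
    rw [this, one_smul]

/-- **`det(1 - σ T ∣ (V_ℓ E)_{I_v}) = 1 - T` at a split multiplicative place `v ∤ ℓ`**, from
`codim (V_ℓ E)^{I_𝔓} = 1` and the Frobenius-only torsion fact (Silverman, *AEC*, C.§16;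
*ATAEC* Ex. 5.13). [cite: SilvermanAEC2009, §C.16 (PDF p. 390)]
[cite: SilvermanATAEC1994, Exercise 5.13(a),(b) (PDF p. 416)] -/
theorem hasseWeilEulerFactor_of_hasSplitMultiplicativeReductionAt_of_codim_of_frobenius_torsion
    [W.IsElliptic] (hTm : W.codimFixed_inertia_rationalTate_eq_one_of_hasMultiplicativeReductionAt ℓ)
    (hBF : W.serreTate_frobenius_smul_torsion_of_hasSplitMultiplicativeReductionAt ℓ)
    (h : Continuous fun x : absoluteGaloisGroup K × RationalTateModule (geomPoints W) ℓ ↦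
      rationalTateRepresentation (absoluteGaloisGroup K) (geomPoints W) ℓ x.1 x.2)
    [Module.Finite ℚ_[ℓ] (W.rationalTateModule ℓ)] {v : HeightOneSpectrum (𝓞 K)}
    (hℓ : (ℓ : 𝓞 K) ∉ v.asIdeal) (hv : W.HasSplitMultiplicativeReductionAt v) :
    hasseWeilEulerFactor (geomPoints W) ℓ h v = 1 - X := by
  have := hasseWeilEulerFactor_eq_of_finrank_eq_one (geomPoints W) ℓ h v 1 fun h𝔓 ↦
    ⟨(W.toInertiaCoinvariants_eq_id_of_hasSplitMultiplicativeReductionAt_of_frobenius_torsion ℓ hTm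
        hBF h hℓ hv h𝔓).1,
      fun σ hσ ↦ by
        rw [(W.toInertiaCoinvariants_eq_id_of_hasSplitMultiplicativeReductionAt_of_frobenius_torsion
          ℓ hTm hBF h hℓ hv h𝔓).2 σ hσ, one_smul]⟩
  rwa [C_1, one_mul] at this

end Derivations

/-! ### Assembly: the corrected Euler-factor fact, Frobenius-only at the split places -/

section EulerFactor

/-- **The corrected Euler-factor fact from Thm. IV.10.2(a) and the two Frobenius torsion facts.**
`hasseWeilEulerFactor_geomPoints_of_isElliptic W ℓ` (Silverman, *AEC*, C.§16) follows from the
two bad-place cases of Silverman *ATAEC* Thm. IV.10.2(a)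
(`codimFixed_inertia_rationalTate_eq_one_of_hasMultiplicativeReductionAt`,
`codimFixed_inertia_rationalTate_eq_two_of_hasAdditiveReductionAt`), the Frobenius-only torsion
fact at the split places (`serreTate_frobenius_smul_torsion_of_hasSplitMultiplicativeReductionAt`)
and the Frobenius torsion fact at the non-split places
(`serreTate_frobenius_smul_torsion_of_hasNonsplitMultiplicativeReductionAt`,
`HasseWeilAbelianEulerFactorTorsion`) — only arithmetic Frobenius elements of `D_𝔓` enter, as in
the definition of `Literature.NumberTheory.EllipticCurves.hasseWeilEulerFactor`; good places:
`hasseWeilEulerFactor_of_hasGoodReduction_holds`.  The case split is that of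
`hasseWeilEulerFactor_geomPoints_of_reductionTypes`.
[cite: SilvermanAEC2009, §C.16 (PDF p. 390)] [cite: SerreTate1968, §1 Lemma 2, §2 Thm. 3] -/
theorem hasseWeilEulerFactor_geomPoints_of_isElliptic_of_codim_of_frobenius_torsion
    (hTm : W.codimFixed_inertia_rationalTate_eq_one_of_hasMultiplicativeReductionAt ℓ)
    (hTa : W.codimFixed_inertia_rationalTate_eq_two_of_hasAdditiveReductionAt ℓ)
    (hBF : W.serreTate_frobenius_smul_torsion_of_hasSplitMultiplicativeReductionAt ℓ)
    (hC : W.serreTate_frobenius_smul_torsion_of_hasNonsplitMultiplicativeReductionAt ℓ) :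
    W.hasseWeilEulerFactor_geomPoints_of_isElliptic ℓ := by
  intro _ h hfin v hℓ
  haveI := hfin
  have hN : W.inertiaCoinvariants_rationalTate_of_hasNonsplitMultiplicativeReductionAt ℓ :=
    W.inertiaCoinvariants_rationalTate_of_hasNonsplitMultiplicativeReductionAt_of_codim_of_frobenius ℓ
      hTm
      (W.frobenius_smul_fixedSubmodule_inertia_rationalTate_of_hasNonsplitMultiplicativeReductionAt_of_torsion
        ℓ hC)
  have hA : W.inertiaCoinvariants_rationalTate_eq_zero_of_hasAdditiveReductionAt ℓ :=
    W.inertiaCoinvariants_rationalTate_eq_zero_of_hasAdditiveReductionAt_of_codim ℓ hTa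
  rcases hasGoodReductionAt_or_hasMultiplicativeReductionAt_or_hasAdditiveReductionAt v W with
    hg | hm | ha
  · exact W.hasseWeilEulerFactor_of_hasGoodReduction_holds ℓ h hfin v hℓ hg
  · by_cases hs : W.HasSplitMultiplicativeReductionAt v
    · rw [W.hasseWeilEulerFactor_of_hasSplitMultiplicativeReductionAt_of_codim_of_frobenius_torsion ℓ
        hTm hBF h hℓ hs, localPolynomialAt_of_hasSplitMultiplicativeReductionAt hs]
      simp
    · rw [W.hasseWeilEulerFactor_of_hasNonsplitMultiplicativeReductionAt ℓ hN h hℓ hm hs,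
        localPolynomialAt_of_hasMultiplicativeReductionAt_of_not_hasSplitMultiplicativeReductionAt
          hm hs]
      simp
  · rw [W.hasseWeilEulerFactor_of_hasAdditiveReductionAt ℓ hA h hℓ ha,
      localPolynomialAt_of_hasAdditiveReductionAt ha]
    simp

/-- **The corrected Euler-factor fact from Serre–Tate's Lemma 2, Frobenius-only at the split
places** (three leaves): the dimension form
`nonempty_fixedSubmodule_inertia_rationalTate_equiv_reductionPoints W ℓ` and the two Frobenius
torsion facts. [cite: SerreTate1968, §1 Lemma 2, §2 Thm. 3] [cite: SilvermanAEC2009, §C.16 (PDF p. 390)] -/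
theorem hasseWeilEulerFactor_geomPoints_of_isElliptic_of_serreTate_of_frobenius_torsion
    (hST : W.nonempty_fixedSubmodule_inertia_rationalTate_equiv_reductionPoints ℓ)
    (hBF : W.serreTate_frobenius_smul_torsion_of_hasSplitMultiplicativeReductionAt ℓ)
    (hC : W.serreTate_frobenius_smul_torsion_of_hasNonsplitMultiplicativeReductionAt ℓ) :
    W.hasseWeilEulerFactor_geomPoints_of_isElliptic ℓ :=
  W.hasseWeilEulerFactor_geomPoints_of_isElliptic_of_codim_of_frobenius_torsion ℓ
    (W.codimFixed_inertia_rationalTate_eq_one_of_hasMultiplicativeReductionAt_of_serreTate ℓ hST)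
    (W.codimFixed_inertia_rationalTate_eq_two_of_hasAdditiveReductionAt_of_serreTate ℓ hST) hBF hC

/-- Pointwise form for an elliptic `W`: the schema instance `hasseWeilEulerFactor_geomPoints W ℓ`
from the three Frobenius-only Serre–Tate leaves. [folklore] -/
theorem hasseWeilEulerFactor_geomPoints_of_serreTate_of_frobenius_torsion [W.IsElliptic]
    (hST : W.nonempty_fixedSubmodule_inertia_rationalTate_equiv_reductionPoints ℓ)
    (hBF : W.serreTate_frobenius_smul_torsion_of_hasSplitMultiplicativeReductionAt ℓ)
    (hC : W.serreTate_frobenius_smul_torsion_of_hasNonsplitMultiplicativeReductionAt ℓ) :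
    W.hasseWeilEulerFactor_geomPoints ℓ :=
  W.hasseWeilEulerFactor_geomPoints_of_of_isElliptic ℓ
    (W.hasseWeilEulerFactor_geomPoints_of_isElliptic_of_serreTate_of_frobenius_torsion ℓ hST hBF hC)

end EulerFactor

end WeierstrassCurve

end
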